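import Mathlib
import Summits.Langlands.Langlands.Theses.OrdinaryPrimeTransport
import Literature.NumberTheory.GaloisRepresentations.InducedGaloisRep

/-!
# Sketch — first lemmas of the crux ideas for `SummandsPotentiallyAutomorphic` (stmt-Langlands-17210)

Ideator planner-cruxidea-stmt-Langlands-17210-1-0, round 1.  Signatures only (`sorry`), they must
ELABORATE; they are the `First lemma:` fields of the two idea cards

* `idea-clifford-descent-imprimitive` — `inducedSummand_descends`, `strongPA_of_induced`;
* `idea-ordinary-family-ribet-dichotomy` — `ribet_two_constituents`, `interlacing_sign`.
-/

open scoped MatrixGroups Matrix Classical Polynomial NumberField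
open NumberField IsDedekindDomain Field Polynomial Filter
open Literature.NumberTheory.Automorphic Literature.NumberTheory.GaloisRepresentations

noncomputable section

namespace Summit.Langlands.Langlands.Cruxes.SummandsPotentiallyAutomorphic.Ideas

/-! ## Card 1 — Clifford–Mackey descent of an imprimitive exact summand -/

/-- **First lemma of `clifford-descent-imprimitive` (Galois half).**  If the exact summand of
`ρ₀` of rank `d * k'` is (conjugate to) the induction `Ind_{Γ_M}^{Γ_K} θ` of a rank-`k'`
representation `θ` along a finite extension `M/K` of degree `d`, then `θ` is an exact summand of
the restriction `ρ₀|_{Γ_M}` (Frobenius reciprocity / Mackey: `θ` is a direct summand of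
`Res_M Ind_M^K θ`; characteristic-polynomial form, so that it feeds the crux over `M` verbatim). -/
theorem inducedSummand_descends {K M : Type} [Field K] [NumberField K] [Field M] [NumberField M]
    [Algebra K M] [FiniteDimensional K M] {ℓ : ℕ} [Fact ℓ.Prime] {d k' m : ℕ}
    (hd : Module.finrank K M = d) (θ : FramedGaloisRep M (PadicAlgCl ℓ) k')
    (σ : FramedGaloisRep K (PadicAlgCl ℓ) (d * k')) (τ : FramedGaloisRep K (PadicAlgCl ℓ) m)
    (ρ₀ : FramedGaloisRep K (PadicAlgCl ℓ) (d * k' + m))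
    (hind : ∃ P : GL (Fin (d * k')) (PadicAlgCl ℓ), FramedRep.conj P (θ.induce K hd) = σ)
    (hsum : ∀ g : absoluteGaloisGroup K, ρ₀.charpoly g = σ.charpoly g * τ.charpoly g) :
    ∃ τ' : FramedGaloisRep M (PadicAlgCl ℓ) ((d - 1) * k' + m),
      ∀ g : absoluteGaloisGroup M,
        (ρ₀.restrictField M).charpoly g = θ.charpoly g * τ'.charpoly g := by
  sorry

/-- **Ascent lemma of `clifford-descent-imprimitive` (automorphic half), in the crux's own
Satake vocabulary.**  `M/K` cyclic of degree `d` (the Clifford field inside `K(ζ_ℓ₀)`),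
`L/K` Galois CM, linearly disjoint from `M` (`IsField (M ⊗[K] L)`); if `θ` is strongly potentially
automorphic with the DESCENDED field `M·L` — for every `E` between `K` and `L` with `L/E` soluble
there is a cuspidal `P''` on `GL_{k'}` over the compositum-level field realised as `E'' = E ⊗ M`-side
(here phrased through restriction of `θ` to the extension `E''` of `M` generated with `E`) — then
`σ = Ind θ` is strongly potentially automorphic with field `L`: cyclic automorphic induction along
`ME/E` (Arthur–Clozel / Henniart, the tree's `automorphicInduction_cyclic_cuspidal`) followed by the
Satake bookkeeping `hasFrobCharpolyAt_induce`.  Stated with `E'' := F''` supplied abstractly as a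
number field with `K → E → F''`, `M → F''` and `[F'' : E] = d`. -/
theorem strongPA_of_induced {K M : Type} [Field K] [NumberField K] [Field M] [NumberField M]
    [Algebra K M] [FiniteDimensional K M] [IsGalois K M] (hcyc : IsCyclic (M ≃ₐ[K] M))
    {ℓ : ℕ} [Fact ℓ.Prime] (ι : PadicAlgCl ℓ ≃+* ℂ) {d k' : ℕ} (hk : 0 < k')
    (hd : Module.finrank K M = d) (θ : FramedGaloisRep M (PadicAlgCl ℓ) k')
    (L : Type) [Field L] [NumberField L] [Algebra K L] [IsGalois K L] (hL : IsCMField L)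
    (hdisj : IsField (TensorProduct K M L))
    (hirr : ((θ.induce K hd).restrictField L).toGaloisRep.IsIrreducible)
    (hθ : ∀ (E : Type) [Field E] [NumberField E] [Algebra K E] [Algebra E L] [IsScalarTower K E L],
      IsSolvable (L ≃ₐ[E] L) →
      ∀ (F'' : Type) [Field F''] [NumberField F''] [Algebra E F''] [Algebra M F''] [Algebra K F'']
        [IsScalarTower K E F''] [IsScalarTower K M F''], Module.finrank E F'' = d →
        ∃ (hF : isCompact_glFiniteIntegralLevel k' F'') (P : CuspidalAutomorphicRepData k' F'' hF),
          ∀ᶠ w : HeightOneSpectrum (𝓞 F'') in cofinite,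
            Summit.Langlands.SatakeFrobCompatibleAt ι P.1 (θ.restrictField F'') w) :
    ∀ (E : Type) [Field E] [NumberField E] [Algebra K E] [Algebra E L] [IsScalarTower K E L],
      IsSolvable (L ≃ₐ[E] L) →
      ∃ (hE : isCompact_glFiniteIntegralLevel (d * k') E) (P : CuspidalAutomorphicRepData (d * k') E hE),
        ∀ᶠ w : HeightOneSpectrum (𝓞 E) in cofinite,
          Summit.Langlands.SatakeFrobCompatibleAt ι P.1 ((θ.induce K hd).restrictField E) w := by
  sorry

/-! ## Card 2 — Ribet dichotomy in the ordinary family of `π` -/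

/-- **First lemma of `ordinary-family-ribet-dichotomy`: Ribet–Bellaïche lattice lemma, two
constituents of distinct ranks, over the formal germ `L⟦T⟧` of a curve in the ordinary family.**
A representation `ρ` of a group `G` on `L⟦T⟧^{a ⊕ b}` whose generic fibre (over `L((T))`) is
absolutely irreducible (Burnside form: the image spans the matrix algebra) and whose special fibre
has the characteristic polynomials of `σ ⊕ τ` (`σ`, `τ` absolutely irreducible of ranks `a ≠ b`)
admits lattices whose reductions are NON-SPLIT extensions in BOTH orders: a non-trivial
`1`-cocycle `c : G → Hom(τ, σ)` (so that `g ↦ (σ g, c g; 0, τ g)` is a representation not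
conjugate to `σ ⊕ τ`) and likewise `c' : G → Hom(σ, τ)`.  (Ribet 1976 Prop. 2.1; Bellaïche–Chenevier,
Astérisque 324, §1.5–1.7.)  Pure algebra; `G` will be `Γ_K`, `L = ℚ̄_ℓ₀`. -/
theorem ribet_two_constituents {G : Type*} [Group G] {L : Type*} [Field L] {a b : ℕ} (hab : a ≠ b)
    (ρ : G →* Matrix (Fin a ⊕ Fin b) (Fin a ⊕ Fin b) (PowerSeries L))
    (hgen : Submodule.span (LaurentSeries L)
        (Set.range fun g : G => (ρ g).map (algebraMap (PowerSeries L) (LaurentSeries L))) = ⊤)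
    (σ : G →* Matrix (Fin a) (Fin a) L) (τ : G →* Matrix (Fin b) (Fin b) L)
    (hσ : Submodule.span L (Set.range fun g : G => σ g) = ⊤)
    (hτ : Submodule.span L (Set.range fun g : G => τ g) = ⊤)
    (hred : ∀ g : G, ((ρ g).map (PowerSeries.constantCoeff (R := L))).charpoly =
        (Matrix.fromBlocks (σ g) 0 0 (τ g)).charpoly) :
    (∃ c : G → Matrix (Fin a) (Fin b) L,
        (∀ g h : G, c (g * h) = σ g * c h + c g * τ h) ∧
        ¬ ∃ X : Matrix (Fin a) (Fin b) L, ∀ g : G, c g = σ g * X - X * τ g) ∧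
    (∃ c' : G → Matrix (Fin b) (Fin a) L,
        (∀ g h : G, c' (g * h) = τ g * c' h + c' g * σ h) ∧
        ¬ ∃ Y : Matrix (Fin b) (Fin a) L, ∀ g : G, c' g = τ g * Y - Y * σ g) := by
  sorry

/-- **Interlacing sign identity** (the Greenberg–Wiles numerology of the dichotomy's branch (I)):
for the position set `S ⊆ Fin p` (`|S| = k`) of `σ`'s exponents inside the full ordinary flag at a
place `v ∣ ℓ₀`, the number `N(σ>τ)` of pairs (`i ∈ S` above `j ∉ S`) and the number `N(τ>σ)` of
pairs (`j ∉ S` above `i ∈ S`) add up to `k (p - k)`; so the local ordinary conditions for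
`Hom(τ,σ)` and `Hom(σ,τ)` have complementary dimensions and the two Selmer Euler characteristics
are opposite, `χ(Hom(τ,σ)) = -χ(Hom(σ,τ))` — at most one of the two Ext-directions produced by
`ribet_two_constituents` has non-negative expected dimension. -/
theorem interlacing_sign {p k : ℕ} (S : Finset (Fin p)) (hS : S.card = k) :
    ((S ×ˢ Sᶜ).filter fun ij : Fin p × Fin p => ij.1 < ij.2).card +
      ((S ×ˢ Sᶜ).filter fun ij : Fin p × Fin p => ij.2 < ij.1).card = k * (p - k) := by
  sorry

end Summit.Langlands.Langlands.Cruxes.SummandsPotentiallyAutomorphic.Ideas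

end
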